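import Summits.QuantumFields.YangMills.Theorems.BalabanUVNodesN07SplitClauseHeadKnitRanged
import Summits.QuantumFields.YangMills.Theorems.BalabanUVNodesN07SplitClauseLevelRaisingMarginWide
import Summits.QuantumFields.YangMills.Theorems.BalabanUVNodesN07SplitClauseHeadKnitMeetNormalised
import Summits.QuantumFields.YangMills.Theorems.BalabanUVNodesN07SplitClauseHeadAtMeetCube
import Summits.QuantumFields.YangMills.Theorems.BalabanUVNodesN07MeetFamilyAtRecord
import Summits.QuantumFields.YangMills.Theorems.BalabanUVNodesN07ShearSizeTopBox
import Literature.MathematicalPhysics.QuantumFieldTheory.Balaban1983to89.Node00.DomainsRefinement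
import HarnessLib

/-!
# N07 [B11] (= [15] = [Balaban1985Variational]) Sect. F, S6 HEAD — THE MEET KNIT UNDER PRINT's NORMALISED LANDAU GAUGE, **TOWER EDITION** (plan g90 ruling YMPLAN-G90-S3-RULING (P1)(ii),
# cure of ⚑ LOCATED-S3-CHART-INTERFACE (F3)): MODULE 67a's knit (p668843) with HS3NORM displaying — and HCHART-MEET-NORM receiving — [15] (152)'s gauge equation `U^{u} = e^{iη_jA}` on the WHOLE
# (1.131) TOWER `□₀` of the datum and the LEVEL-WEIGHTED letters `|A| < κ·ε_j·L^{j−j′}` on every `□_{j′}`, `j′ ≤ j`, not only the four top letters on the print box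

Cell `pub-ymgap`, seat `pub-ymgap-dag-n07-e` g25 (FAN-OUT §N07 row s3; LANE OWNER of the K0 road), MODULE 67c (INTENT-67c, cell bus).  `--kind proof --supports stmt-QuantumFields-20541 --as helper`
(K0⁷); count-neutral; def-free.  [15] = [Balaban1985Variational]; [6] = [Balaban1985RegularSpaces]; [4] = [Balaban1984PropagatorsII]; [I] = [Balaban1987RG1].

WHY.  Located memo `HOME/pub-ymgap-dag-n07-e/LOCATED-S3-CHART-INTERFACE.md` (F3): HS3NORM-67a displays the gauge equation and the (152) letters on `regionOfSet (cover ″ printBox)` only, but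
the chart lane's (143) ⇒ (157) ⇒ (158) derivation and its FAR data rows `B c` ((155)) need `A` on all free bonds of print's local family (150) — the whole tower — with the level weight of
(152) «|A| ≤ O(1)·ε·(Lʲη)⁻¹ on Ω′_j»; the S3 lane's torus door `Node00.TorusCoverLandau153TowerWindow.exists_localGauge152_tower_window_of_gaugedBoundB8` (dag-n07-w3 g7) already delivers, for
any window `X ⊆ □₀`, the gauge equation on `regionOfSet (cover ″ X)` and `‖A‖ ≤ 2r·(Lʲη_n)⁻¹` on the bonds of `X ∩ □_j`.  THIS FILE is MODULE 67a VERBATIM with TWO ROWS INSERTED in HS3NORM's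
conclusion (and, at the same place, in HCHART-MEET-NORM's premise list) after the print-box gauge-equation row:
(T1) `∀ b ∈ (Sect2.regionOfSet (F.P K) (cover ″ cube L (cornerP Mc ρ idx) (sideP Mc ρ) ρ (K − n) 0)).bonds, U^{u}(b) = e^{iη_{K−n}A(b)}` — the gauge equation on `□₀` (`B8Eq131Cubes.cube … 0`,
[6] p. 98 «□_j is a sum of the big blocks», the largest cube of the (1.131) tower);
(T2) `∀ j′ ≤ K − n, ∀ b ∈ (Sect2.regionOfSet (F.P K) (cover ″ cube L (cornerP …) (sideP …) ρ (K − n) j′)).bonds, ‖A b‖ < κ·ε_{K−n}·L^{K−n−j′}` — (152)'s level-weighted letters on `□_{j′}`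
(in the units `η_{K−n}` of the gauge equation; `j′ = K − n` is the print-box letter, `j′ = 0` the boundedness of `U^{u} − 1` on `□₀`).
The print-box rows of 67a (gauge equation, `‖A b‖ < κε`, the dpair and the two deep-bond letters), the (153) row for the MEET sequence and the abstract `Nrm` row stay BYTE-IDENTICAL (the print-box rows
are the `j′ = K − n` restrictions of (T1)∕(T2): `box ⊆ cube … (K − n) ⊆ cube … 0`, `B8Eq131Cubes.box_subset_cube`, `Sect2.regionOfSet_bonds_mono` — kept so the head's consumers are untouched).
With (T2) the chart's FAR rows are free (`B c := Q_c(A)`, `|Q_c(η A)| ≤ κε_j` by the level weight) and LOCATED-COLLAR-ROWS needs no (146)-propagation (memo (F3), plan (P1)(ii)).  `Nrm` is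
ABSTRACT exactly as in 67a; its text of record is MODULE 60″ `NrmOfRecordWideC` (plan ruling A1.1 (M2)) at instantiation.  The proof is 67a's: MODULE 66's print-margin reduction
`datumGaugeSplitTopStepCoreG_of_marginCleanPrint`, the head's `localGaugeSplitOn_head159_meetCube_box` at zero shear, the record side (57a collar, FILE D0 `Adm22`, block saturation), with the two
new rows passed from HS3NORM to HCHART-MEET-NORM.  MODULES 59 ∕ 65a ∕ 67a stay correct AS STATED; this edition's HS3NORM is STRONGER (more displayed output) and its HCHART-MEET-NORM WEAKER (more
premises) than 67a's — same conclusion.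

WHAT IS PROVED (sorry-free; no definition; axioms standard).  ★★★ `datumGaugeSplitTopStepCoreG_of_normalisedGauge_of_chartMeetTower F N`.  (The guarded [15] Prop. 8 step token from it is the
sibling `…HeadKnitMeetNormalisedTowerStep`, line budget.)
HONEST SCOPE.  Count-neutral by-name composition; HS3NORM-67c (print-margin-clean, tower rows), HCHART-MEET-NORM-67c, HLETTERS-NORM ∕ HBUDGET-NORM, the two guard hypotheses and the letters are
HYPOTHESES — displayed, NOT discharged, joint satisfiability at the record NOT claimed; the door-to-be of HS3NORM-67c is the S3 item SPEC D90-S3W1 (E1–E4, S1 = this clause with `Nrm := 60″`), NOT in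
the tree; `Nrm` abstract; NO stub registered or closed; nothing of [15]∕[6]∕[4] ANALYSIS asserted; K0⁷ ∕ K1⁹ NOT closed; N07 ∕ N05 NOT discharged; counts unmoved (typed 28∕28 · discharged 7∕28);
one finite 𝕋⁴ programme at fixed ε — the route closes the conditional finite-𝕋⁴ rung `BalabanLadder.UV` ONLY; the YM mass gap (Clay) is NOT proved by any of this; nothing continuum ∕ ℝ⁴ ∕ OS.
No `sorry`, no `def`, no `instance`, no `notation`.

References: [15] (144) p. 300, (147)–(156) pp. 301–302, (157)–(159) pp. 302–303, (160)–(166) pp. 303–304, (168) p. 304, Prop. 8 p. 304; [6] Thm. 2 p. 83, p. 98, Prop. 6 (1.135)–(1.138)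
p. 99, (1.29) p. 81, (1.3)–(1.9) p. 77, (1.131) p. 99; [4] (2.1)–(2.4) p. 224, Cor. 2.8 p. 249; [I] (0.1) p. 251.
-/

set_option autoImplicit false

noncomputable section
open scoped BigOperators Matrix.Norms.L2Operator

namespace Summit.QuantumFields.YangMills.BalabanUVNodes.N07SplitClauseHeadKnitMeetNormalisedTower

open Literature.MathematicalPhysics.QuantumFieldTheory.Balaban1983to89
open Literature.MathematicalPhysics.QuantumFieldTheory.Balaban1983to89.Node00
open Literature.MathematicalPhysics.QuantumFieldTheory.Balaban1983to89.B15DeterminingSets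
open Literature.MathematicalPhysics.QuantumFieldTheory.Balaban1983to89.B12RegularSpaces111 (gaugeU expI grad)
open B15Eq112TorusCover (cover)
open B14DomainGeom (Pt Within)
open B14.Eq213MaximalDomains (side cubeExt)
open B5Eq117TorusCarriers (Mk)
open B5Eq118OneStroke (iterBlockOf)
open B5Prop12FieldsLattice (distSite)
open B8Eq131Cubes (sqLo sqHi box cube)
open B8LeafModelZd (ZdIdx)
open B11Eq115Space (levOf)
open B6SectADomainsV1 (Domains)
open B6SectAOperatorsV1 (BondIdx RE dsE QpE)
open Literature.MathematicalPhysics.QuantumFieldTheory.BalabanImbrieJaffe1984to88.BIJ85AxialPropagator411 (BondSpace)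
open T4Continuum (T4Family)
open T4AxialGaugeSmallField (castSite)
open B16Sect1Backgrounds (toMS)
open GaugeField (gaugeAct)
open MatrixLog (mlog)
open Summit.QuantumFields.YangMills.Theorems.K0FlatCubeOpsTextP (flatH)
open Summit.QuantumFields.YangMills.BalabanUVNodes.N07HalvingStepTopOfLocalLetters (Letters10On)
open Summit.QuantumFields.YangMills.BalabanUVNodes.N07LocalLettersSplitCore (LocalGaugeSplitOn)
open Summit.QuantumFields.YangMills.BalabanUVNodes.N07LocalLettersCoreGuarded (DatumGaugeSplitTopStepCoreG)
open Summit.QuantumFields.YangMills.BalabanUVNodes.N07SplitClauseHeadAtMeetCube (localGaugeSplitOn_head159_meetCube_box)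
open Summit.QuantumFields.YangMills.BalabanUVNodes.N07MeetFamilyAtRecord (adm22_meetCube_trunc_seqOfRecord cover_mem_Ω_pred_of_meet_box)
open Summit.QuantumFields.YangMills.BalabanUVNodes.N07RecordDomainsAdm22 (blockSat_seqOfRecord)
open Summit.QuantumFields.YangMills.BalabanUVNodes.N07DatumGauge152Guarded (numerics_cornerP_of_levelGuard)
open Summit.QuantumFields.YangMills.BalabanUVNodes.N07SplitClauseLevelRaisingMarginWide (datumGaugeSplitTopStepCoreG_of_marginCleanPrint)
open Summit.QuantumFields.YangMills.BalabanUVNodes.N07SplitClauseHeadKnitMeetNormalised (grad_zero_fun split159_of_zero_shear)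
open Summit.QuantumFields.YangMills.BalabanUVNodes.N07ShearSizeTopBox (dist1_iter_avOfRecord_gaugeAct_one dist1_iter_avOfRecord_one)

/-! ## §1  The knit under the normalised gauge -/

open scoped Classical in
/-- ★★★ **THE MEET KNIT UNDER PRINT's NORMALISED LANDAU GAUGE, TOWER EDITION** (statement in the header; MODULE 67a with HS3NORM ∕ HCHART-MEET-NORM carrying (152)'s gauge equation on the whole tower `□₀`
and the level-weighted letters `‖A b‖ < κ·ε_j·L^{j−j′}` on every `□_{j′}`, `j′ ≤ j`): the guarded per-datum token `DatumGaugeSplitTopStepCoreG F N suppDom Mc ρ Adm B₃ C θ Q κ a₀ a₁` for every guard `Adm`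
implying the V20-G conjuncts and the run's grid numerics, every letter `κ ≥ 0`, and every normalisation predicate `Nrm`, modulo the displayed HS3NORM-67c (print's (152)–(153) on the tower WITH
«`ū_j = 1` on `Λ′_j`» at every meeting, print-margin-clean datum), HCHART-MEET-NORM-67c (print's (154)–(159), shear-free), HLETTERS-NORM and HBUDGET-NORM (no `σ`, no `t_D`).
[cite: Balaban1985Variational, (144) p.300, (147)–(156) pp.301–302, (157)–(159) pp.302–303, (160)–(166) pp.303–304, (168) p.304, Prop. 8 p.304; Balaban1985RegularSpaces, Thm. 2 p.83, (1.29) p.81, p.98 (□̃, □_j), Prop. 6 (1.135)–(1.138) p.99, (1.131) p.99; Balaban1984PropagatorsII, (2.1)–(2.4) p.224, Cor. 2.8 (2.150)–(2.151) p.249] -/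
theorem datumGaugeSplitTopStepCoreG_of_normalisedGauge_of_chartMeetTower (F : T4Family) (N : ℕ) [NeZero N] :
    ∃ (Mh₀ R₀ : ℕ) (CH δH BH : ℝ), 0 ≤ CH ∧ 0 < δH ∧ 0 < BH ∧
    ∀ {ρ : ℕ}
      -- structural letters: grid cube `Mc`, block height `a′` (`M_h = L^{a′} ≥ M_h⁰`), `R ≥ R₀`, the collar `ρ` with `L·M_h ∣ ρ`, `R·L·M_h ≤ ρ`, `L ≤ ρ`
      {Mc Mh R a' : ℕ} (_ : 1 ≤ Mc) (_ : Mc ≤ ρ) (_ : Mh = F.L ^ a') (_ : Mh₀ ≤ Mh) (_ : R₀ ≤ R) (_ : F.L * Mh ∣ ρ) (_ : R * (F.L * Mh) ≤ ρ) (hLρ : F.L ≤ ρ)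
      -- the two constants of the plan's V20-G guard `c ≤ ν.M₁ ∧ k + c₀ ≤ F.m + K` and their side conditions (as in FILE D)
      {c c₀ : ℕ} (_ : (11 * 4 + 4 * ρ + Mc + 3) * F.L ≤ c) (_ : Mc + 11 * 4 + 6 * ρ ≤ 2 * F.L ^ c₀) (_ : F.m ≤ c₀) (_ : a' + 3 ≤ c₀)
      -- ★ THE GUARD: any step guard implying the V20-G conjuncts AND the run's grid numerics the meet's (2.1) needs (`hgran`, `hdiv`)
      (Adm : StepGuard F) (_ : ∀ (ν : Stage7Numerics) (M : ℕ) (g : ℕ → ℝ) (K k : ℕ) (s : SeqOfRecord F ν M g K k), Adm ν M g K k s → c ≤ ν.M₁ ∧ k + c₀ ≤ F.m + K)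
      (_ : ∀ (ν : Stage7Numerics) (M : ℕ) (g : ℕ → ℝ) (K k : ℕ) (s : SeqOfRecord F ν M g K k), Adm ν M g K k s → ∀ j : ℕ, 1 ≤ j → j ≤ k →
        F.L * Mh ∣ M * RkOfRecord (F.P K).L ν.r (g j) ∧ dCubeSide (F.P K).L M (RkOfRecord (F.P K).L ν.r (g j)) j ∣ (F.P K).sitesPerDir 0)
      -- the token's letters, `0 < B₃`, the FREE (152)-letter `κ ≥ 0`, the (163)-type letter `θ_H` of the `H` doors
      {B₃ C θ Q κ a₀ a₁ θH : ℝ} (_ : 0 < B₃) (_ : 0 ≤ C) (_ : 0 ≤ θ) (_ : 0 ≤ Q) (_ : 0 ≤ κ) (_ : 8 * CH * BH * Real.exp (-(δH * (ρ : ℝ))) ≤ θH)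
      -- the chart side's PER-LEVEL SIZE LETTERS, functions of the letters `(ε, δ)` and the level only — NO shear letters `σ ∕ v ∕ av`
      (β₁ β₂ s' t₁ : (ℕ → ℝ) → (ℕ → ℝ) → ℕ → ℝ)
      -- ★ HLETTERS-NORM (RANGED): signs only, IN THE TOKEN's RANGE `0 < δ_j ≤ a₁`, `B₃δ_j ≤ ε_j ≤ a₀`
      (_ : ∀ (ε δ : ℕ → ℝ) (j : ℕ), 0 < δ j → δ j ≤ a₁ → B₃ * δ j ≤ ε j → ε j ≤ a₀ → 0 ≤ β₁ ε δ j ∧ 0 ≤ β₂ ε δ j ∧ 0 ≤ s' ε δ j)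
      -- ★ HBUDGET-NORM (RANGED): thresholds above FILE C's two floors summing STRICTLY below the token's threshold — no `t_D`, no `C_S·B_S`
      (_ : ∀ (K : ℕ) (ε δ : ℕ → ℝ) (j : ℕ), 0 < δ j → δ j ≤ a₁ → B₃ * δ j ≤ ε j → ε j ≤ a₀ → ∃ t₂ t₃ : ℝ,
        1 / 4 * ((sideP (F.P K) Mc ρ : ℕ) : ℝ) * max (4 * CH * BH * β₁ ε δ j) (θH * β₂ ε δ j) < t₂ ∧ 2 * CH * BH * s' ε δ j < t₃ ∧
        t₁ ε δ j + t₂ + t₃ < C * δ j + θ * ε j + Q * ε j ^ 2)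
      -- ★ THE NORMALISATION PREDICATE (abstract): print's «`ū_j = 1` on `Λ′_j`» in the record currency the S3 pens and the chart lane agree
      (Nrm : ∀ (ν : Stage7Numerics) (M : ℕ) (g : ℕ → ℝ) (K k : ℕ), SeqOfRecord F ν M g K k → GaugeField (F.P K) 0 (SU N) → ℕ → Pt (F.P K).d →
        GaugeTransf (F.P K) 0 (SU N) → (PBond (F.P K) 0 → MatA N) → Prop)
      -- ★ HS3NORM-67c: [6] Thm. 2's NORMALISED local Landau gauge at every MEETING, PRINT-MARGIN-CLEAN datum — (152) on the whole TOWER (gauge equation on `□₀`, level-weighted letters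
      --   `< κ·ε_j·L^{j−j′}` on `□_{j′}`), the print-box letters `< κ·ε_j`, (153) for the MEET sequence, and `Nrm`
      (_ : ∀ (ν : Stage7Numerics) (M : ℕ) (g : ℕ → ℝ) (K k : ℕ) (s : SeqOfRecord F ν M g K k), Sect2.SeqSeparated ν.M₁ s → 0 < ν.M₁ →
        Adm ν M g K k s → 1 ≤ k →
        ∀ (ε δ : ℕ → ℝ),
        (∀ n, n ≤ k → 0 < δ n ∧ δ n ≤ a₁) → (∀ n, n < k → δ n ≤ 2 * δ (n + 1)) → (∀ n, n < k → δ (n + 1) ≤ 2 * δ n) →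
        (∀ n, n ≤ k → B₃ * δ n ≤ ε n ∧ ε n ≤ a₀) → (∀ n, n < k → ε n ≤ 2 * ε (n + 1)) → (∀ n, n < k → ε (n + 1) ≤ 2 * ε n) →
        ∀ W : MSField (F.P K) (SU N), Sect2.DataSmall7PTop (avOfRecord F N K) s.Ω (suppDomOfRecord F ν K s.Ω) k δ W →
        ∀ U : GaugeField (F.P K) 0 (SU N),
        (∀ n, n ≤ k → PlaqSmallOn (Sect2.omegaPlaqsTop s.Ω (suppDomOfRecord F ν K s.Ω) n) (ε n * (F.P K).eta n ^ 2) U) →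
        (∀ n, n ≤ k → Sect2.CoDivSmallOn (Sect2.omegaBondsTop s.Ω (suppDomOfRecord F ν K s.Ω) n) (ε n * (F.P K).eta n ^ 3) U) →
        AgreeOn (genSet s.Ω k) (avgFamily (avOfRecord F N K) U) W → IsCritOnFibre F N K (genSet s.Ω k) W U →
        ∀ (n : ℕ) (hk : K - n ≤ (F.P K).m + (F.P K).K), 1 ≤ K - n → K - n ≤ k → ∀ (idx : Pt (F.P K).d),
        (∃ x ∈ box (F.P K).L (cornerP (F.P K) Mc ρ idx) (sideP (F.P K) Mc ρ) (K - n), ∃ y : Pt (F.P K).d, cover (F.P K) y ∈ s.Ω (K - n) ∧ Within ((3 : ℕ) : ℤ) x y) →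
        (K - n = k ∨ ∀ z ∈ box (F.P K).L (cornerP (F.P K) Mc ρ idx - ((2 * ρ : ℕ) : Pt (F.P K).d)) (sideP (F.P K) Mc ρ + 2 * (2 * ρ)) (K - n),
          cover (F.P K) z ∉ s.Ω (K - n + 1)) →
        ∃ (u : GaugeTransf (F.P K) 0 (SU N)) (A : PBond (F.P K) 0 → MatA N),
        (∀ b ∈ (Sect2.regionOfSet (F.P K) (cover (F.P K) '' box (F.P K).L (cornerP (F.P K) Mc ρ idx) (sideP (F.P K) Mc ρ) (K - n))).bonds,
          gaugeU (fun x => ιSU N (u x)) (fun b' => ιSU N (U b')) b = expI ((F.P K).eta (K - n)) (A b)) ∧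
        -- (T1) the gauge equation on the WHOLE TOWER `□₀` of the datum ([6] p. 98, (1.131))
        (∀ b ∈ (Sect2.regionOfSet (F.P K) (cover (F.P K) '' cube (F.P K).L (cornerP (F.P K) Mc ρ idx) (sideP (F.P K) Mc ρ) ρ (K - n) 0)).bonds,
          gaugeU (fun x => ιSU N (u x)) (fun b' => ιSU N (U b')) b = expI ((F.P K).eta (K - n)) (A b)) ∧
        -- (T2) (152)'s LEVEL-WEIGHTED letters on every `□_{j′}`, `j′ ≤ K − n`
        (∀ j', j' ≤ K - n →
          ∀ b ∈ (Sect2.regionOfSet (F.P K) (cover (F.P K) '' cube (F.P K).L (cornerP (F.P K) Mc ρ idx) (sideP (F.P K) Mc ρ) ρ (K - n) j')).bonds,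
            ‖A b‖ < κ * ε (K - n) * ((F.P K).L : ℝ) ^ (K - n - j')) ∧
        (∀ b ∈ (Sect2.regionOfSet (F.P K) (cover (F.P K) '' box (F.P K).L (cornerP (F.P K) Mc ρ idx) (sideP (F.P K) Mc ρ) (K - n))).bonds,
          ‖A b‖ < κ * ε (K - n)) ∧
        (∀ q ∈ (Sect2.regionOfSet (F.P K) (cover (F.P K) '' box (F.P K).L (cornerP (F.P K) Mc ρ idx) (sideP (F.P K) Mc ρ) (K - n))).dpairs,
          ‖grad ((F.P K).eta (K - n)) q.2.1 (fun y => A ⟨y, q.2.2⟩) q.1‖ < κ * ε (K - n)) ∧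
        (∀ b ∈ Sect2.bondsDeep (cover (F.P K) '' box (F.P K).L (cornerP (F.P K) Mc ρ idx) (sideP (F.P K) Mc ρ) (K - n)),
          ‖Sect2.codiffCurlA ((F.P K).eta (K - n)) A b.src b.dir‖ < κ * ε (K - n)) ∧
        (∀ b ∈ Sect2.bondsDeep (cover (F.P K) '' box (F.P K).L (cornerP (F.P K) Mc ρ idx) (sideP (F.P K) Mc ρ) (K - n)),
          ‖∑ ν' : Fin (F.P K).d, (((F.P K).eta (K - n) : ℝ) : ℂ)⁻¹ •
              (grad ((F.P K).eta (K - n)) ν' (fun y => A ⟨y, b.dir⟩) (b.src.unshift ν') - grad ((F.P K).eta (K - n)) ν' (fun y => A ⟨y, b.dir⟩) b.src)‖ <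
            κ * ε (K - n)) ∧
        (∀ D' : Domains (F.P K), LinearMap.ker (QpE D') ≤
            LinearMap.ker (QpE (domainsMeet (cubeDomains (F.P K) (cornerP (F.P K) Mc ρ idx) (sideP (F.P K) Mc ρ) ρ (K - n) hk) (domainsOfSeq s.Ω (K - n) hk))) →
          ∀ φ : MatA N →L[ℂ] ℂ,
          RE D' ((F.P K).eta (K - n))⁻¹ (dsE ((F.P K).eta (K - n))⁻¹ (WithLp.toLp 2 fun b => (φ (A b)).re : BondSpace (F.P K))) = 0 ∧
          RE D' ((F.P K).eta (K - n))⁻¹ (dsE ((F.P K).eta (K - n))⁻¹ (WithLp.toLp 2 fun b => (φ (A b)).im : BondSpace (F.P K))) = 0) ∧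
        Nrm ν M g K k s U (K - n) idx u A)
      -- ★ HCHART-MEET-NORM-67c: the chart lane's per-datum deliverable at PRINT's (150) FAMILY `D″` UNDER THE NORMALISED GAUGE — print's (154)–(159), shear-free — now GIVEN (152) on the
      --   whole tower ((T1) gauge equation on `□₀`, (T2) level-weighted letters on every `□_{j′}`): the FAR rows are free (`B c := Q_c(A)`)
      (_ : ∀ (ν : Stage7Numerics) (M : ℕ) (g : ℕ → ℝ) (K k : ℕ) (s : SeqOfRecord F ν M g K k), Sect2.SeqSeparated ν.M₁ s → 0 < ν.M₁ →
        Adm ν M g K k s → 1 ≤ k →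
        ∀ (ε δ : ℕ → ℝ),
        (∀ n, n ≤ k → 0 < δ n ∧ δ n ≤ a₁) → (∀ n, n < k → δ n ≤ 2 * δ (n + 1)) → (∀ n, n < k → δ (n + 1) ≤ 2 * δ n) →
        (∀ n, n ≤ k → B₃ * δ n ≤ ε n ∧ ε n ≤ a₀) → (∀ n, n < k → ε n ≤ 2 * ε (n + 1)) → (∀ n, n < k → ε (n + 1) ≤ 2 * ε n) →
        ∀ W : MSField (F.P K) (SU N), Sect2.DataSmall7PTop (avOfRecord F N K) s.Ω (suppDomOfRecord F ν K s.Ω) k δ W →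
        ∀ U : GaugeField (F.P K) 0 (SU N),
        (∀ n, n ≤ k → PlaqSmallOn (Sect2.omegaPlaqsTop s.Ω (suppDomOfRecord F ν K s.Ω) n) (ε n * (F.P K).eta n ^ 2) U) →
        (∀ n, n ≤ k → Sect2.CoDivSmallOn (Sect2.omegaBondsTop s.Ω (suppDomOfRecord F ν K s.Ω) n) (ε n * (F.P K).eta n ^ 3) U) →
        AgreeOn (genSet s.Ω k) (avgFamily (avOfRecord F N K) U) W → IsCritOnFibre F N K (genSet s.Ω k) W U →
        ∀ (n : ℕ) (hk : K - n ≤ (F.P K).m + (F.P K).K), 1 ≤ K - n → K - n ≤ k → ∀ (idx : Pt (F.P K).d),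
        -- MEETING DATUMS ONLY: the print box has a point within `3` of a lift of a site of `Ω_{K−n}`
        (∃ x ∈ box (F.P K).L (cornerP (F.P K) Mc ρ idx) (sideP (F.P K) Mc ρ) (K - n), ∃ y : Pt (F.P K).d, cover (F.P K) y ∈ s.Ω (K - n) ∧ Within ((3 : ℕ) : ℤ) x y) →
        -- PRINT-MARGIN-CLEAN DATUMS ONLY (print p. 300 + (144)'s margin cube «□̃» = the print box WIDENED BY `2ρ` BLOCKS): top level, or «□̃» misses `Ω_{j+1}`
        (K - n = k ∨ ∀ z ∈ box (F.P K).L (cornerP (F.P K) Mc ρ idx - ((2 * ρ : ℕ) : Pt (F.P K).d)) (sideP (F.P K) Mc ρ + 2 * (2 * ρ)) (K - n),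
          cover (F.P K) z ∉ s.Ω (K - n + 1)) →
        -- THE FAMILY: print's (150) `Ω′_j = □_j (j < k), Ω′_k = □_k ∩ Ω_k`
        ∀ {HVd : Domains (F.P K)}
          (_ : HVd = domainsMeet (cubeDomains (F.P K) (cornerP (F.P K) Mc ρ idx) (sideP (F.P K) Mc ρ) ρ (K - n) hk) (domainsOfSeq s.Ω (K - n) hk))
          (lo hi : ℕ → Pt (F.P K).d),
        lo 0 = (fun i => ((F.P K).L : ℤ) * (sqLo (F.P K).L (cornerP (F.P K) Mc ρ idx) ρ (K - n) 1 i - 1)) →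
        hi 0 = (fun i => ((F.P K).L : ℤ) * (sqHi (F.P K).L (cornerP (F.P K) Mc ρ idx) (sideP (F.P K) Mc ρ) ρ (K - n) 1 i + 1) + (((F.P K).L : ℤ) - 1)) →
        (∀ j', 1 ≤ j' → lo j' = sqLo (F.P K).L (cornerP (F.P K) Mc ρ idx) ρ (K - n) j' - 1) →
        (∀ j', 1 ≤ j' → hi j' = sqHi (F.P K).L (cornerP (F.P K) Mc ρ idx) (sideP (F.P K) Mc ρ) ρ (K - n) j' + 1) →
        ∃ HV : (BondIdx HVd → MatA N) →ₗ[ℂ] (PBond (F.P K) 0 → MatA N),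
          (∀ (Bf : BondIdx HVd → MatA N) (b : PBond (F.P K) 0), HV Bf b = ∑ c, ((flatH (F.P K) (K - n) HVd (Pi.single c 1) b : ℝ) : ℂ) • Bf c) ∧
        ∀ (u : GaugeTransf (F.P K) 0 (SU N)) (A : PBond (F.P K) 0 → MatA N),
        (∀ b ∈ (Sect2.regionOfSet (F.P K) (cover (F.P K) '' box (F.P K).L (cornerP (F.P K) Mc ρ idx) (sideP (F.P K) Mc ρ) (K - n))).bonds,
          gaugeU (fun x => ιSU N (u x)) (fun b' => ιSU N (U b')) b = expI ((F.P K).eta (K - n)) (A b)) →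
        -- (T1) the gauge equation on the WHOLE TOWER `□₀` of the datum
        (∀ b ∈ (Sect2.regionOfSet (F.P K) (cover (F.P K) '' cube (F.P K).L (cornerP (F.P K) Mc ρ idx) (sideP (F.P K) Mc ρ) ρ (K - n) 0)).bonds,
          gaugeU (fun x => ιSU N (u x)) (fun b' => ιSU N (U b')) b = expI ((F.P K).eta (K - n)) (A b)) →
        -- (T2) (152)'s LEVEL-WEIGHTED letters on every `□_{j′}`, `j′ ≤ K − n`
        (∀ j', j' ≤ K - n →
          ∀ b ∈ (Sect2.regionOfSet (F.P K) (cover (F.P K) '' cube (F.P K).L (cornerP (F.P K) Mc ρ idx) (sideP (F.P K) Mc ρ) ρ (K - n) j')).bonds,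
            ‖A b‖ < κ * ε (K - n) * ((F.P K).L : ℝ) ^ (K - n - j')) →
        (∀ b ∈ (Sect2.regionOfSet (F.P K) (cover (F.P K) '' box (F.P K).L (cornerP (F.P K) Mc ρ idx) (sideP (F.P K) Mc ρ) (K - n))).bonds,
          ‖A b‖ < κ * ε (K - n)) →
        (∀ q ∈ (Sect2.regionOfSet (F.P K) (cover (F.P K) '' box (F.P K).L (cornerP (F.P K) Mc ρ idx) (sideP (F.P K) Mc ρ) (K - n))).dpairs,
          ‖grad ((F.P K).eta (K - n)) q.2.1 (fun y => A ⟨y, q.2.2⟩) q.1‖ < κ * ε (K - n)) →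
        (∀ b ∈ Sect2.bondsDeep (cover (F.P K) '' box (F.P K).L (cornerP (F.P K) Mc ρ idx) (sideP (F.P K) Mc ρ) (K - n)),
          ‖Sect2.codiffCurlA ((F.P K).eta (K - n)) A b.src b.dir‖ < κ * ε (K - n)) →
        (∀ b ∈ Sect2.bondsDeep (cover (F.P K) '' box (F.P K).L (cornerP (F.P K) Mc ρ idx) (sideP (F.P K) Mc ρ) (K - n)),
          ‖∑ ν' : Fin (F.P K).d, (((F.P K).eta (K - n) : ℝ) : ℂ)⁻¹ •
              (grad ((F.P K).eta (K - n)) ν' (fun y => A ⟨y, b.dir⟩) (b.src.unshift ν') - grad ((F.P K).eta (K - n)) ν' (fun y => A ⟨y, b.dir⟩) b.src)‖ <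
            κ * ε (K - n)) →
        (∀ D' : Domains (F.P K), LinearMap.ker (QpE D') ≤ LinearMap.ker (QpE HVd) → ∀ φ : MatA N →L[ℂ] ℂ,
          RE D' ((F.P K).eta (K - n))⁻¹ (dsE ((F.P K).eta (K - n))⁻¹ (WithLp.toLp 2 fun b => (φ (A b)).re : BondSpace (F.P K))) = 0 ∧
          RE D' ((F.P K).eta (K - n))⁻¹ (dsE ((F.P K).eta (K - n))⁻¹ (WithLp.toLp 2 fun b => (φ (A b)).im : BondSpace (F.P K))) = 0) →
        -- ★ THE NORMALISATION of this `u` (print's «ū_j = 1 on Λ′_j»), as delivered by HS3NORM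
        Nrm ν M g K k s U (K - n) idx u A →
        -- print's (154)–(159): the centre `x_c`, the DATA rows `B` ((160) near, centred; (155) far), the small datum `B′`, the (158)∕(165) summand `A₁`, and `A = A₁ + H_V B − H_V B′`
        ∃ (xc : Pt (F.P K).d) (B B' : BondIdx HVd → MatA N) (A₁ : PBond (F.P K) 0 → MatA N),
          xc ∈ box (F.P K).L (cornerP (F.P K) Mc ρ idx) (sideP (F.P K) Mc ρ) (K - n) ∧
          (∀ c : BondIdx HVd, ((c.1.1 : ℕ) = K - n ∨ blockOf c.1.2.src ∈ (cubeDomains (F.P K) (cornerP (F.P K) Mc ρ idx) (sideP (F.P K) Mc ρ) ρ (K - n) hk).Om ((c.1.1 : ℕ) + 1)) →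
            ‖B c‖ ≤ β₁ ε δ (K - n) * (distSite (Mk (F.P K) (c.1.1 : ℕ)) c.1.2.src (iterBlockOf (c.1.1 : ℕ) (cover (F.P K) xc)) + 1)) ∧
          (∀ c : BondIdx HVd, ¬ ((c.1.1 : ℕ) = K - n ∨ blockOf c.1.2.src ∈ (cubeDomains (F.P K) (cornerP (F.P K) Mc ρ idx) (sideP (F.P K) Mc ρ) ρ (K - n) hk).Om ((c.1.1 : ℕ) + 1)) →
            ‖B c‖ ≤ β₂ ε δ (K - n) * ((ρ : ℝ) + ((sideP (F.P K) Mc ρ : ℕ) : ℝ))) ∧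
          (∀ c, ‖B' c‖ ≤ s' ε δ (K - n)) ∧
          Letters10On (cover (F.P K) '' box (F.P K).L (cornerP (F.P K) Mc ρ idx) (sideP (F.P K) Mc ρ) (K - n)) ((F.P K).eta (K - n)) (t₁ ε δ (K - n)) A₁ ∧
          (∀ b, A b = A₁ b + HV B b - HV B' b)),
      DatumGaugeSplitTopStepCoreG F N (fun ν K Ω => suppDomOfRecord F ν K Ω) Mc ρ Adm B₃ C θ Q κ a₀ a₁ := by
  obtain ⟨Mh₀, R₀, CS, BS, CH, δH, BH, -, -, hCH, hδH, hBH, hmain⟩ := localGaugeSplitOn_head159_meetCube_box F N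
  refine ⟨Mh₀, R₀, CH, δH, BH, hCH, hδH, hBH, ?_⟩
  intro ρ Mc Mh R a' hMc hMcρ hMha hMh hR hdvd hRρ hLρ c c₀ hc hc₀ hmc₀ hac₀ Adm hAdm₁ hAdm₂ B₃ C θ Q κ a₀ a₁ θH hB₃ hC0 hθ0 hQ0 hκ0 h163
    β₁ β₂ s' t₁ hletters hbudget Nrm hS3 hchart
  -- the width-generic margin level-raising reduction at PRINT's width `w = 2ρ` (MODULE 66): the clause is owed at PRINT-MARGIN-CLEAN datums whose print box MEETS `Ω_j`
  refine datumGaugeSplitTopStepCoreG_of_marginCleanPrint F N hMc hMcρ hB₃.le hκ0 hC0 hθ0 hQ0 ?_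
  intro ν M g K k s hsep hM₁ hadm hk ε δ hδ hcompδ hcompδ' hε hεcomp hεcomp' W h7 U h17 h19 hfib hcrit j hj hjk a hmeet hclean
  -- the guard's two halves: the V20-G conjuncts and the run's grid numerics
  have hV20 : c ≤ ν.M₁ ∧ k + c₀ ≤ F.m + K := hAdm₁ ν M g K k s hadm
  have hgrid := hAdm₂ ν M g K k s hadm
  -- the level guard with `F.m ≤ c₀` puts every datum level below `K`: write it as `K − n`
  have hkK : k ≤ K := by have := hV20.2; omega
  obtain ⟨n, rfl⟩ : ∃ n, j = K - n := ⟨K - j, by omega⟩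
  have hk1 : 1 ≤ K - n := hj
  have hkP : K - n ≤ (F.P K).m + (F.P K).K := by
    have : (F.P K).m + (F.P K).K = F.m + K := rfl
    omega
  have hLρ' : (F.P K).L ≤ ρ := hLρ
  -- the letters' ranges at the datum's level
  have hr1 : 0 < δ (K - n) := (hδ _ hjk).1
  have hr2 : δ (K - n) ≤ a₁ := (hδ _ hjk).2
  have hr3 : B₃ * δ (K - n) ≤ ε (K - n) := (hε _ hjk).1
  have hr4 : ε (K - n) ≤ a₀ := (hε _ hjk).2
  obtain ⟨hβ₁, hβ₂, hs'⟩ := hletters ε δ (K - n) hr1 hr2 hr3 hr4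
  obtain ⟨t₂, t₃, ht₂, ht₃, hsum⟩ := hbudget K ε δ (K - n) hr1 hr2 hr3 hr4
  -- ★ S3's NORMALISED gauge at this meeting, clean datum (HS3NORM), and the datum's numerics from the level guard
  obtain ⟨u, A, he, heT, hAT, hA, hdA, hcd, hlap, h6, hnrm⟩ := hS3 ν M g K k s hsep hM₁ hadm hk ε δ hδ hcompδ hcompδ' hε hεcomp hεcomp' W h7 U h17 h19
    hfib hcrit n hkP hk1 hjk a hmeet hclean
  obtain ⟨ha, hM, hper, hinj⟩ := numerics_cornerP_of_levelGuard F hk1 hjk hV20.2 hMha (by omega) hLρ' hdvd hc₀ a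
  have hρpos : 0 < ρ := lt_of_lt_of_le (F.P K).L_pos hLρ'
  have hM1 : 1 ≤ sideP (F.P K) Mc ρ := by have := le_sideP (P := F.P K) Mc hρpos; omega
  -- the canonical boxes of the datum's tower
  set lo : ℕ → Pt (F.P K).d := fun j' => if j' = 0 then (fun i => ((F.P K).L : ℤ) * (sqLo (F.P K).L (cornerP (F.P K) Mc ρ a) ρ (K - n) 1 i - 1))
    else sqLo (F.P K).L (cornerP (F.P K) Mc ρ a) ρ (K - n) j' - 1 with hlo
  set hi : ℕ → Pt (F.P K).d := fun j' => if j' = 0 then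
      (fun i => ((F.P K).L : ℤ) * (sqHi (F.P K).L (cornerP (F.P K) Mc ρ a) (sideP (F.P K) Mc ρ) ρ (K - n) 1 i + 1) + (((F.P K).L : ℤ) - 1))
    else sqHi (F.P K).L (cornerP (F.P K) Mc ρ a) (sideP (F.P K) Mc ρ) ρ (K - n) j' + 1 with hhi
  have hlo0 : lo 0 = fun i => ((F.P K).L : ℤ) * (sqLo (F.P K).L (cornerP (F.P K) Mc ρ a) ρ (K - n) 1 i - 1) := by simp [hlo]
  have hhi0 : hi 0 = fun i => ((F.P K).L : ℤ) * (sqHi (F.P K).L (cornerP (F.P K) Mc ρ a) (sideP (F.P K) Mc ρ) ρ (K - n) 1 i + 1) + (((F.P K).L : ℤ) - 1) := by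
    simp [hhi]
  have hloj : ∀ j', 1 ≤ j' → lo j' = sqLo (F.P K).L (cornerP (F.P K) Mc ρ a) ρ (K - n) j' - 1 := fun j' hj' => by
    simp [hlo, Nat.one_le_iff_ne_zero.mp hj']
  have hhij : ∀ j', 1 ≤ j' → hi j' = sqHi (F.P K).L (cornerP (F.P K) Mc ρ a) (sideP (F.P K) Mc ρ) ρ (K - n) j' + 1 := fun j' hj' => by
    simp [hhi, Nat.one_le_iff_ne_zero.mp hj']
  -- THE RECORD SIDE OF THE MEET: nesting, block saturation (grid numerics), the window's collar «π(□) ⊆ Ω_{K−n−1}» (57a), and `Adm22 D″ R (L·M_h)` (FILE D0)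
  have hnest : ∀ i : ℕ, 1 ≤ i → i < K - n → s.Ω (i + 1) ⊆ s.Ω i := fun i h1 hi => s.chain.Ω_succ_subset_Ω h1 (lt_of_lt_of_le hi hjk)
  have hdiv : ∀ j' : ℕ, 1 ≤ j' → j' ≤ K - n → dCubeSide (F.P K).L M (RkOfRecord (F.P K).L ν.r (g j')) j' ∣ (F.P K).sitesPerDir 0 :=
    fun j' h1 hj' => (hgrid j' h1 (hj'.trans hjk)).2
  have hgran : ∀ j' : ℕ, 1 ≤ j' → j' ≤ K - n → F.L * Mh ∣ M * RkOfRecord (F.P K).L ν.r (g j') := fun j' h1 hj' => (hgrid j' h1 (hj'.trans hjk)).1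
  have hsat : ∀ (j' : ℕ) (x x' : Site (F.P K) 0), 1 ≤ j' → j' ≤ K - n → iterBlockOf j' x = iterBlockOf j' x' → x ∈ s.Ω j' → x' ∈ s.Ω j' :=
    fun j' x x' h1 hj' => blockSat_seqOfRecord F ν M g K k (by have : (F.P K).m + (F.P K).K = F.m + K := rfl; omega) s (fun i h1 hi => (hgrid i h1 hi).2) j' x x' h1
      (hj'.trans hjk)
  have hν1 : 1 ≤ ν.M₁ := hM₁
  have hfloor : 11 * (F.P K).d + 2 * ρ + Mc + 3 ≤ ν.M₁ := by
    have hd : (F.P K).d = 4 := rfl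
    have hL1 : 1 ≤ F.L := by have := F.hL11; omega
    have : (11 * 4 + 4 * ρ + Mc + 3) ≤ (11 * 4 + 4 * ρ + Mc + 3) * F.L := Nat.le_mul_of_pos_right _ hL1
    rw [hd]; omega
  have hbox' : 2 ≤ K - n → ∀ z ∈ box (F.P K).L (cornerP (F.P K) Mc ρ a) (sideP (F.P K) Mc ρ) (K - n), cover (F.P K) z ∈ s.Ω (K - n - 1) :=
    fun h2 => cover_mem_Ω_pred_of_meet_box F ν M g K k s hν1 hsep hfloor h2 hjk hmeet
  have hLMh : 1 ≤ F.L * Mh := by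
    rw [hMha]
    exact Nat.one_le_iff_ne_zero.mpr (Nat.mul_ne_zero (by have := F.hL11; omega) (pow_ne_zero _ (by have := F.hL11; omega)))
  have hRsep : R * (F.L * Mh) + 1 ≤ (F.P K).L * ν.M₁ := by
    have hLP : (F.P K).L = F.L := rfl
    have hL1 : 1 ≤ F.L := by have := F.hL11; omega
    have h1 : ν.M₁ ≤ F.L * ν.M₁ := Nat.le_mul_of_pos_left _ hL1
    have h2 : ρ + 1 ≤ c := by
      have : (11 * 4 + 4 * ρ + Mc + 3) ≤ (11 * 4 + 4 * ρ + Mc + 3) * F.L := Nat.le_mul_of_pos_right _ hL1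
      omega
    rw [hLP]; omega
  have hAdmD := adm22_meetCube_trunc_seqOfRecord F ν M g K k s hjk hkP hLMh hν1 hRsep hsep hdiv hgran hdvd ha hM hper hRρ
  -- the chart side at this MEETING, CLEAN datum, at print's family, UNDER THE NORMALISED GAUGE: print's (154)–(159), no shear devices
  obtain ⟨HV, hHV, hch⟩ := hchart ν M g K k s hsep hM₁ hadm hk ε δ hδ hcompδ hcompδ' hε hεcomp hεcomp' W h7 U h17 h19 hfib hcrit n hkP hk1 hjk a hmeet hclean rfl
    lo hi hlo0 hhi0 hloj hhij
  obtain ⟨xc, B, B', A₁, hxc, hX₁, hX₂, hB', h₁, h159⟩ := hch u A he heT hAT hA hdA hcd hlap h6 hnrm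
  -- FILE C at this datum AT ZERO SHEAR (`u_L := 1, U₁ := 1, λ := 0, X := 0, v := av := 0, σ := 0`, `t_D :=` the budget's slack), then the token's threshold exactly
  have hDσ : ∀ j' ≤ K - n, ((((F.P K).d * ((sideP (F.P K) Mc ρ + 4 * ρ + 3) * (F.P K).L ^ ((K - n) - j'))) : ℕ) : ℝ) * ((0 : ℝ) + 0) ≤ 0 :=
    fun _ _ => by simp
  have hv : ∀ j' ≤ K - n, ∀ c' : PBond (F.P K) j', c'.src ∈ (castSite '' Set.Icc (lo j') (hi j') : Set (Site (F.P K) j')) →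
      c'.tgt ∈ (castSite '' Set.Icc (lo j') (hi j') : Set (Site (F.P K) j')) →
        dist1 (Averaging.iter (avOfRecord F N K) j' (gaugeAct (fun _ => (1 : SU N)) (1 : GaugeField (F.P K) 0 (SU N))) c') ≤ (0 : ℝ) :=
    fun j' _ c' _ _ => dist1_iter_avOfRecord_gaugeAct_one F N K j' c'
  have hav : ∀ j' ≤ K - n, ∀ c' : PBond (F.P K) j', c'.src ∈ (castSite '' Set.Icc (lo j') (hi j') : Set (Site (F.P K) j')) →
      c'.tgt ∈ (castSite '' Set.Icc (lo j') (hi j') : Set (Site (F.P K) j')) →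
        dist1 (Averaging.iter (avOfRecord F N K) j' (1 : GaugeField (F.P K) 0 (SU N)) c') ≤ (0 : ℝ) :=
    fun j' _ c' _ _ => dist1_iter_avOfRecord_one F N K j' c'
  have hlam : ∀ (j' : ℕ) (y : Site (F.P K) j'), ‖(fun (_ : ℕ) (_ : Site (F.P K) j') => (0 : MatA N)) j' y‖ ≤
      ‖mlog (((((toMS (fun _ : Site (F.P K) 0 => (1 : SU N)) j' (castSite (lo j')))⁻¹ * toMS (fun _ : Site (F.P K) 0 => (1 : SU N)) j' y)⁻¹ : SU N)) : MatA N)‖ :=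
    fun _ _ => by rw [norm_zero]; exact norm_nonneg _
  have hX : ∀ c' : BondIdx (domainsMeet (cubeDomains (F.P K) (cornerP (F.P K) Mc ρ a) (sideP (F.P K) Mc ρ) ρ (K - n) hkP) (domainsOfSeq s.Ω (K - n) hkP)),
      (fun _ => (0 : MatA N)) c' = LatticeFieldCalculus.grad (((F.P K).L : ℝ) ^ (K - n) / ((F.P K).L : ℝ) ^ (c'.1.1 : ℕ))
        ((fun (_ : ℕ) (_ : Site (F.P K) _) => (0 : MatA N)) c'.1.1) c'.1.2 :=
    fun c' => (grad_zero_fun _ _).symm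
  have h159' : ∀ b, A b - HV (fun _ => (0 : MatA N)) b = A₁ b + HV B b - HV B' b := split159_of_zero_shear HV h159
  set tD : ℝ := C * δ (K - n) + θ * ε (K - n) + Q * ε (K - n) ^ 2 - (t₁ ε δ (K - n) + t₂ + t₃) with htD_def
  have htD : 2 * CS * BS * (4 * (0 : ℝ)) < tD := by
    have h0 : (0 : ℝ) < tD := sub_pos.mpr hsum
    simpa using h0
  have hclause := hmain n K hk1 (by omega) hkP hMha hMh hR (by omega) hM1 hLρ hinj s.Ω hnest hsat hbox' hAdmD hHV hxc hβ₁ hβ₂ h163 hX₁ hX₂ hs' hB'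
    hlo0 hhi0 hloj hhij (fun _ => (1 : SU N)) (1 : GaugeField (F.P K) 0 (SU N)) (fun _ => (0 : ℝ)) (fun _ => (0 : ℝ)) (fun _ => le_rfl) (fun _ => le_rfl)
    (by norm_num) hDσ hv hav (fun (_ : ℕ) (_ : Site (F.P K) _) => (0 : MatA N)) hlam hX u he hA hdA h₁ h159' ht₂ ht₃ htD
  exact hclause.of_le le_rfl (le_of_eq (by rw [htD_def]; ring))

end Summit.QuantumFields.YangMills.BalabanUVNodes.N07SplitClauseHeadKnitMeetNormalisedTower

end
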